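import Literature.MathematicalPhysics.QuantumFieldTheory.Balaban1983to89.Node00.OpsYOfLetters

/-!
# NODE 00 — BOND COORDINATES of the operator layer's letters: `FBondY i ≃ Fin (d+1) × SiteY i` (a fine bond = (direction, charted source))
# and the induced coordinate changes of bond FUNCTIONS and bond OPERATORS (dag-n06-c G-SIDE-PLAN, DESIGN POINT 0)

[B9] = Bałaban, *Propagators for lattice gauge theories in a background field*, CMP 99 (1985) 389–434: the lattice `T_η` and its positively
oriented bonds `b = ⟨x, x + ηe_μ⟩` (3.1) p.390; the bond-sector operators of Sect. A act on functions of bonds ((3.4)–(3.9) pp.391–392).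

WHY THIS FILE (dag-n06-c g12 `G-SIDE-PLAN.md`, Route L, DESIGN POINT 0).  def-Y's letters type the bond sector over `FBondY i := PBond (PV …) 0`
(a Setup-torus bond: `src : Site (PV …) 0`, `dir : Fin (d+1)`), while the site sector — and n06-c's ∕ r06's coded block-carrier frames
(`B9SectBKerFrameV3.CinvFrame₃`, `B9SectBGFrameV3.GFrame₃`: bond letters `Gb, Qb, Qsb, ab, F₂ : Module.End ℝ ((κ × S i) × ι → ℝ)` with `κ = Fin (d+1)`,
`S i = SiteY i`) — live on NODE 00's box chart `SiteY i = ↥(toKT i).XB`.  The two are identified by the CHART `B6GlobalChartV1.boxEquiv i.hN` applied to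
the source: ★ `bondCoordsY i : FBondY i ≃ Fin (d+1) × SiteY i`, `b ↦ (b.dir, boxEquiv b.src)`.  Everything else here is the induced bookkeeping a consumer
needs to conjugate def-Y's bond objects (`GAY`, `QY`, `QsY`, `deltaAY`, `kernelFamilyB∕BU` readings) onto the `(κ × S)`-carrier: the `ℂ`-linear coordinate
change of bond functions ★ `bondFunCoordsY i : (FBondY i → 𝔸) ≃ₗ[ℂ] (Fin (d+1) × SiteY i → 𝔸)` and of bond operators ★ `bondOpCoordsY i := (bondFunCoordsY i).conj :
Module.End ℂ (FBondY i → 𝔸) ≃ₗ[ℂ] Module.End ℂ (Fin (d+1) × SiteY i → 𝔸)` (multiplicative, unital, unit-preserving), and the coordinates of the structural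
letters: the background `U b.dir b.src = UboxY i U κ z` at `(κ, z) = bondCoordsY i b`, and the final point `boxEquiv b.tgt = shiftY i b.dir (boxEquiv b.src)`
(`B6ScalarChartV1.toBox_shift`).  Restriction of scalars to `ℝ` and realification through a basis `b : Module.Basis ι ℝ 𝔸` (n06-c's `conj b`) are the
consumer's and compose with these by `LinearEquiv.restrictScalars`; nothing here chooses a basis.

WHAT IS IN THE FILE (`def`s + `rfl`∕`simp` bookkeeping; 0 sorry).  §1 ★ `bondCoordsY` + apply∕symm faces + the bond count `card_fBondY`; §2 structural letters in
coordinates (`boxEquiv_tgt`, `boxEquiv_tgt_bondCoordsY_symm`, `coe_cfg_eq_UboxY_bondCoordsY`, `UboxY_eq_cfg_bondCoordsY_symm`); §3 ★ `bondFunCoordsY` + faces (over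
any `ℂ`-module `𝔸`); §4 ★ `bondOpCoordsY` + `_apply`, `_apply_apply`, `_mul`, `_one`, `_injective`, `_mul_eq_one_iff`, `_isUnit_iff`, the mixed pre-∕post-compositions
`precompBondCoordsY` (bond functions INTO another carrier, e.g. `QY parB U`) ∕ `postcompBondCoordsY` (OUT OF another carrier, e.g. `QsY parB U`) and the
factorisation `bondOpCoordsY_comp` of a composite through a middle carrier.

HONEST SCOPE.  DICTIONARY ONLY (an `Equiv` built from the landed chart bijection and its functorial images); no operator of [B9] is constructed or
estimated; nothing of Thms 3.1–3.4 asserted; COUNT-NEUTRAL; N06 NOT discharged; one finite 𝕋⁴ programme at fixed ε — nothing continuum, nothing about the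
mass gap.  No `sorry`, `axiom`, `instance`, `notation`.  Cell `pub-ymgap` (HUMAN RULING D-0062), Track A node N06 [B9] row 13 (Sect. B, G side),
seat `pub-ymgap-node00-def-Y` (g24), 2026-08-28.

RELATED IN THE TREE, NOT DUPLICATED: `Node00.OpsYOfLetters` (`SiteY`, `FBondY`, `IBondY`, `CfgY`, `UboxY`, `shiftY` USED BY NAME), `B6GlobalChartV1.boxEquiv`
(the chart), `B6ScalarChartV1.toBox_shift` (chart ∘ shift = box shift ∘ chart), `Setup.PBond` (its `Fintype` instance is the same pairing with the UNcharted
source; not re-issued).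
-/

noncomputable section

namespace Literature.MathematicalPhysics.QuantumFieldTheory.Balaban1983to89.Node00

open B6GlobalChartV1 (PV boxEquiv)
open B6KLevelCensusIndexV1 (KIdx)

variable {d ℓ : ℕ} {hd : 1 ≤ d + 1} {hL : Odd (ℓ + 1) ∧ 1 < ℓ + 1} {b₀ b₁ : ℝ}

/-! ## §1 The bond coordinates -/

/-- ★ **BOND COORDINATES**: a fine positively oriented bond `⟨x, x + ηe_μ⟩` IS the pair (direction `μ`, charted source `boxEquiv x`) — the carrier
`κ × S = Fin (d+1) × SiteY i` of the coded bond letters. [cite: Balaban1985BackgroundPropagators, (3.1) p.390, dictionary (chart `B6GlobalChartV1.boxEquiv`)] -/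
def bondCoordsY (i : KIdx d ℓ hd hL b₀ b₁) : FBondY i ≃ Fin (d + 1) × SiteY i where
  toFun b := (b.dir, boxEquiv i.hN b.src)
  invFun p := ⟨(boxEquiv i.hN).symm p.2, p.1⟩
  left_inv b := by cases b; simp only [Equiv.symm_apply_apply]
  right_inv p := by simp only [Equiv.apply_symm_apply, Prod.mk.eta]

variable (i : KIdx d ℓ hd hL b₀ b₁)

/-- first coordinate = the direction. [cite: Balaban1985BackgroundPropagators, (3.1) p.390, dictionary] -/
@[simp] theorem bondCoordsY_apply_fst (b : FBondY i) : (bondCoordsY i b).1 = b.dir := rfl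

/-- second coordinate = the charted source. [cite: Balaban1985BackgroundPropagators, (3.1) p.390, dictionary] -/
@[simp] theorem bondCoordsY_apply_snd (b : FBondY i) : (bondCoordsY i b).2 = boxEquiv i.hN b.src := rfl

/-- the pair form. [cite: Balaban1985BackgroundPropagators, (3.1) p.390, dictionary] -/
theorem bondCoordsY_apply (b : FBondY i) : bondCoordsY i b = (b.dir, boxEquiv i.hN b.src) := rfl

/-- inverse: direction. [cite: Balaban1985BackgroundPropagators, (3.1) p.390, dictionary] -/
@[simp] theorem bondCoordsY_symm_apply_dir (p : Fin (d + 1) × SiteY i) : ((bondCoordsY i).symm p).dir = p.1 := rfl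

/-- inverse: source = the uncharted site. [cite: Balaban1985BackgroundPropagators, (3.1) p.390, dictionary] -/
@[simp] theorem bondCoordsY_symm_apply_src (p : Fin (d + 1) × SiteY i) : ((bondCoordsY i).symm p).src = (boxEquiv i.hN).symm p.2 := rfl

/-- inverse on a pair `(μ, z)`. [cite: Balaban1985BackgroundPropagators, (3.1) p.390, dictionary] -/
theorem bondCoordsY_symm_mk (μ : Fin (d + 1)) (z : SiteY i) : (bondCoordsY i).symm (μ, z) = ⟨(boxEquiv i.hN).symm z, μ⟩ := rfl

/-- **bond count**: `#bonds = (d+1) · #sites`. [cite: Balaban1985BackgroundPropagators, (3.1) p.390, folklore] -/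
theorem card_fBondY : Fintype.card (FBondY i) = (d + 1) * Fintype.card (SiteY i) := by
  rw [Fintype.card_congr (bondCoordsY i), Fintype.card_prod, Fintype.card_fin]

/-! ## §2 The structural letters in coordinates -/

/-- **the final point in coordinates**: the chart of `b₊ = x + e_μ` is the box shift `shiftY i μ` of the chart of `x` (`B6ScalarChartV1.toBox_shift`).
[cite: Balaban1985BackgroundPropagators, (3.1), (3.3) p.390, dictionary] -/
theorem boxEquiv_tgt (b : FBondY i) : boxEquiv i.hN b.tgt = shiftY i b.dir (boxEquiv i.hN b.src) :=
  B6ScalarChartV1.toBox_shift i.hN b.src b.dir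

/-- the final point of the bond with coordinates `(μ, z)` charts to `shiftY i μ z`. [cite: Balaban1985BackgroundPropagators, (3.1), (3.3) p.390, dictionary] -/
theorem boxEquiv_tgt_bondCoordsY_symm (μ : Fin (d + 1)) (z : SiteY i) : boxEquiv i.hN ((bondCoordsY i).symm (μ, z)).tgt = shiftY i μ z := by
  rw [boxEquiv_tgt]; simp

section Background

variable {𝔸 : Type} [NormedRing 𝔸] [NormedAlgebra ℂ 𝔸] [CompleteSpace 𝔸]

/-- **the background in coordinates**: `U(b) = U_μ(z)` — the bond variable of `U : CfgY 𝔸 i` at `b` is the charted background `UboxY i U` at `bondCoordsY i b`.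
[cite: Balaban1985BackgroundPropagators, (3.1) p.390, dictionary] -/
theorem coe_cfg_eq_UboxY_bondCoordsY (U : CfgY 𝔸 i) (b : FBondY i) : U b.dir b.src = UboxY i U (bondCoordsY i b).1 (bondCoordsY i b).2 := by
  simp only [bondCoordsY_apply_fst, bondCoordsY_apply_snd, UboxY, Equiv.symm_apply_apply]

/-- the same, read from a coordinate pair. [cite: Balaban1985BackgroundPropagators, (3.1) p.390, dictionary] -/
theorem UboxY_eq_cfg_bondCoordsY_symm (U : CfgY 𝔸 i) (μ : Fin (d + 1)) (z : SiteY i) :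
    UboxY i U μ z = U ((bondCoordsY i).symm (μ, z)).dir ((bondCoordsY i).symm (μ, z)).src := rfl

end Background

/-! ## §3 Bond functions in coordinates -/

section Linear

variable {𝔸 : Type*} [AddCommMonoid 𝔸] [Module ℂ 𝔸]

/-- ★ **COORDINATE CHANGE OF BOND FUNCTIONS** (`ℂ`-linear): `J ↦ ((μ, z) ↦ J ⟨boxEquiv⁻¹ z, μ⟩)`. [cite: Balaban1985BackgroundPropagators, (3.1) p.390, dictionary] -/
def bondFunCoordsY : (FBondY i → 𝔸) ≃ₗ[ℂ] (Fin (d + 1) × SiteY i → 𝔸) :=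
  LinearEquiv.funCongrLeft ℂ 𝔸 (bondCoordsY i).symm

/-- value at a coordinate pair. [cite: Balaban1985BackgroundPropagators, (3.1) p.390, dictionary] -/
@[simp] theorem bondFunCoordsY_apply (J : FBondY i → 𝔸) (p : Fin (d + 1) × SiteY i) : bondFunCoordsY i J p = J ((bondCoordsY i).symm p) := rfl

/-- inverse: value at a bond. [cite: Balaban1985BackgroundPropagators, (3.1) p.390, dictionary] -/
@[simp] theorem bondFunCoordsY_symm_apply (g : Fin (d + 1) × SiteY i → 𝔸) (b : FBondY i) : (bondFunCoordsY i).symm g b = g (bondCoordsY i b) := by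
  have h : bondFunCoordsY i (fun b' => g (bondCoordsY i b')) = g := by
    funext p; simp only [bondFunCoordsY_apply, Equiv.apply_symm_apply]
  have h' := congrArg (bondFunCoordsY (𝔸 := 𝔸) i).symm h
  rw [LinearEquiv.symm_apply_apply] at h'
  exact (congrFun h' b).symm

/-- the coordinate change of the function `b ↦ J b` evaluated back at `bondCoordsY i b` is `J b`. [cite: Balaban1985BackgroundPropagators, (3.1) p.390, dictionary] -/
@[simp] theorem bondFunCoordsY_apply_bondCoordsY (J : FBondY i → 𝔸) (b : FBondY i) : bondFunCoordsY i J (bondCoordsY i b) = J b := by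
  simp

/-! ## §4 Bond operators in coordinates -/

/-- ★ **COORDINATE CHANGE OF BOND OPERATORS**: conjugation by `bondFunCoordsY` — `f ↦ bondFunCoordsY ∘ f ∘ bondFunCoordsY⁻¹`.
[cite: Balaban1985BackgroundPropagators, (3.4)–(3.9) pp.391–392, dictionary] -/
def bondOpCoordsY : Module.End ℂ (FBondY i → 𝔸) ≃ₗ[ℂ] Module.End ℂ (Fin (d + 1) × SiteY i → 𝔸) :=
  (bondFunCoordsY i).conj

/-- the conjugation formula. [cite: Balaban1985BackgroundPropagators, (3.4)–(3.9) pp.391–392, dictionary] -/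
theorem bondOpCoordsY_apply (f : Module.End ℂ (FBondY i → 𝔸)) (g : Fin (d + 1) × SiteY i → 𝔸) :
    bondOpCoordsY i f g = bondFunCoordsY i (f ((bondFunCoordsY i).symm g)) := by
  simp [bondOpCoordsY, LinearEquiv.conj_apply]

/-- pointwise: `(f̃ g)(μ, z) = (f (g ∘ bondCoordsY)) ⟨boxEquiv⁻¹ z, μ⟩`. [cite: Balaban1985BackgroundPropagators, (3.4)–(3.9) pp.391–392, dictionary] -/
theorem bondOpCoordsY_apply_apply (f : Module.End ℂ (FBondY i → 𝔸)) (g : Fin (d + 1) × SiteY i → 𝔸) (p : Fin (d + 1) × SiteY i) :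
    bondOpCoordsY i f g p = f (fun b => g (bondCoordsY i b)) ((bondCoordsY i).symm p) := by
  rw [bondOpCoordsY_apply, bondFunCoordsY_apply]
  congr 2

/-- multiplicative. [cite: Balaban1985BackgroundPropagators, (3.4)–(3.9) pp.391–392, folklore] -/
theorem bondOpCoordsY_mul (f g : Module.End ℂ (FBondY i → 𝔸)) :
    bondOpCoordsY i (f * g) = bondOpCoordsY i f * bondOpCoordsY i g := by
  simp only [bondOpCoordsY, Module.End.mul_eq_comp, LinearEquiv.conj_comp]

/-- unital. [cite: Balaban1985BackgroundPropagators, (3.4)–(3.9) pp.391–392, folklore] -/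
@[simp] theorem bondOpCoordsY_one : bondOpCoordsY (𝔸 := 𝔸) i 1 = 1 := by
  simp only [bondOpCoordsY, Module.End.one_eq_id, LinearEquiv.conj_id]

/-- injective on operators (it is a linear equivalence). [cite: Balaban1985BackgroundPropagators, (3.4)–(3.9) pp.391–392, folklore] -/
theorem bondOpCoordsY_injective : Function.Injective (bondOpCoordsY (𝔸 := 𝔸) i) := (bondOpCoordsY i).injective

/-- inverse relation transported: `f g = 1 ↔ f̃ g̃ = 1`. [cite: Balaban1985BackgroundPropagators, (3.4)–(3.9) pp.391–392, folklore] -/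
theorem bondOpCoordsY_mul_eq_one_iff (f g : Module.End ℂ (FBondY i → 𝔸)) :
    bondOpCoordsY i f * bondOpCoordsY i g = 1 ↔ f * g = 1 := by
  rw [← bondOpCoordsY_mul, ← bondOpCoordsY_one (𝔸 := 𝔸) i, (bondOpCoordsY_injective (𝔸 := 𝔸) i).eq_iff]

/-- **units transport**: `f` is invertible iff its coordinate form is. [cite: Balaban1985BackgroundPropagators, (3.4)–(3.9) pp.391–392, folklore] -/
theorem bondOpCoordsY_isUnit_iff (f : Module.End ℂ (FBondY i → 𝔸)) : IsUnit (bondOpCoordsY i f) ↔ IsUnit f := by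
  constructor
  · rintro ⟨u, hu⟩
    refine ⟨⟨f, (bondOpCoordsY i).symm (↑u⁻¹ : Module.End ℂ _), ?_, ?_⟩, rfl⟩
    · rw [← bondOpCoordsY_mul_eq_one_iff (𝔸 := 𝔸) i, LinearEquiv.apply_symm_apply, ← hu, Units.mul_inv]
    · rw [← bondOpCoordsY_mul_eq_one_iff (𝔸 := 𝔸) i, LinearEquiv.apply_symm_apply, ← hu, Units.inv_mul]
  · rintro ⟨u, rfl⟩
    refine ⟨⟨bondOpCoordsY i (↑u : Module.End ℂ _), bondOpCoordsY i (↑u⁻¹ : Module.End ℂ _), ?_, ?_⟩, rfl⟩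
    · rw [← bondOpCoordsY_mul, Units.mul_inv, bondOpCoordsY_one]
    · rw [← bondOpCoordsY_mul, Units.inv_mul, bondOpCoordsY_one]

/-- mixed letters (bond functions INTO another carrier `X`, e.g. the coarse averaging `QY parB U : (FBondY i → 𝔸) →ₗ[ℂ] (IBondY i → 𝔸)`) in bond
coordinates: precomposition with `bondFunCoordsY⁻¹`. [cite: Balaban1985BackgroundPropagators, (3.11) p.392, dictionary] -/
def precompBondCoordsY {X : Type*} [AddCommMonoid X] [Module ℂ X] (T : (FBondY i → 𝔸) →ₗ[ℂ] X) : (Fin (d + 1) × SiteY i → 𝔸) →ₗ[ℂ] X :=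
  T ∘ₗ (bondFunCoordsY (𝔸 := 𝔸) i).symm.toLinearMap

/-- its value. [cite: Balaban1985BackgroundPropagators, (3.11) p.392, dictionary] -/
@[simp] theorem precompBondCoordsY_apply {X : Type*} [AddCommMonoid X] [Module ℂ X] (T : (FBondY i → 𝔸) →ₗ[ℂ] X) (g : Fin (d + 1) × SiteY i → 𝔸) :
    precompBondCoordsY i T g = T ((bondFunCoordsY i).symm g) := rfl

/-- and it recovers `T` on coordinates of bond functions. [cite: Balaban1985BackgroundPropagators, (3.11) p.392, dictionary] -/
@[simp] theorem precompBondCoordsY_bondFunCoordsY {X : Type*} [AddCommMonoid X] [Module ℂ X] (T : (FBondY i → 𝔸) →ₗ[ℂ] X) (J : FBondY i → 𝔸) :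
    precompBondCoordsY i T (bondFunCoordsY i J) = T J := by
  simp [precompBondCoordsY]

/-- mixed letters OUT OF another carrier into bond functions (e.g. `QsY parB U : (IBondY i → 𝔸) →ₗ[ℂ] (FBondY i → 𝔸)`, the flat curl's adjoint) in bond
coordinates: postcomposition with `bondFunCoordsY`. [cite: Balaban1985BackgroundPropagators, (3.12) p.392, dictionary] -/
def postcompBondCoordsY {X : Type*} [AddCommMonoid X] [Module ℂ X] (T : X →ₗ[ℂ] (FBondY i → 𝔸)) : X →ₗ[ℂ] (Fin (d + 1) × SiteY i → 𝔸) :=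
  (bondFunCoordsY (𝔸 := 𝔸) i).toLinearMap ∘ₗ T

/-- its value. [cite: Balaban1985BackgroundPropagators, (3.12) p.392, dictionary] -/
@[simp] theorem postcompBondCoordsY_apply {X : Type*} [AddCommMonoid X] [Module ℂ X] (T : X →ₗ[ℂ] (FBondY i → 𝔸)) (v : X) (p : Fin (d + 1) × SiteY i) :
    postcompBondCoordsY i T v p = T v ((bondCoordsY i).symm p) := rfl

/-- **composites factor**: a bond operator written as `T₂ ∘ T₁` through a middle carrier has coordinate form `postcomp T₂ ∘ precomp T₁`
(e.g. `QsY ∘ QY`-type bond averagings). [cite: Balaban1985BackgroundPropagators, (3.11)–(3.12) p.392, dictionary] -/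
theorem bondOpCoordsY_comp {X : Type*} [AddCommMonoid X] [Module ℂ X] (T₁ : (FBondY i → 𝔸) →ₗ[ℂ] X) (T₂ : X →ₗ[ℂ] (FBondY i → 𝔸)) :
    bondOpCoordsY i (T₂ ∘ₗ T₁) = postcompBondCoordsY i T₂ ∘ₗ precompBondCoordsY i T₁ := by
  apply LinearMap.ext; intro g
  rw [bondOpCoordsY_apply]; rfl

end Linear

end Literature.MathematicalPhysics.QuantumFieldTheory.Balaban1983to89.Node00
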